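import Mathlib
import HarnessLib
import Summits.ValiantsHypothesis.ValiantsHypothesis.Theses.MonotoneRestoration
import Literature.Computability.AlgebraicComplexity.ArithCircuit
import Literature.Computability.AlgebraicComplexity.ArithCircuitProofs
import Literature.Computability.AlgebraicComplexity.MonotoneStructure
import Literature.Computability.AlgebraicComplexity.PermanentIrreducible
import Literature.ModelTheory.FiniteModelTheory.CkEquiv
import Summits.ValiantsHypothesis.ValiantsHypothesis.Theorems.MonotoneRestorationMonotoneRestorationQPCosetCount
import Summits.ValiantsHypothesis.ValiantsHypothesis.Theorems.MonotoneRestorationMonotoneRestorationQPSymmetricLB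
import Summits.ValiantsHypothesis.ValiantsHypothesis.Theorems.MonotoneRestorationMonotoneRestorationQPSupportSymmetrisation
import Summits.ValiantsHypothesis.ValiantsHypothesis.Theorems.MonotoneRestorationMonotoneRestorationQPSparseRegime
import Summits.ValiantsHypothesis.ValiantsHypothesis.Theorems.MonotoneRestorationMonotoneRestorationQPBeta
import Literature.Computability.AlgebraicComplexity.SymmetricArithCircuit
import Literature.Computability.AlgebraicComplexity.DawarWilsenach2025Proofs
import Literature.GroupTheory.PermutationGroups.SmallIndexSubgroups
import Summits.ValiantsHypothesis.ValiantsHypothesis.Theorems.MonotoneRestorationQP.Negative.LoadBearing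
import Summits.ValiantsHypothesis.ValiantsHypothesis.Theorems.MonotoneRestorationMonotoneRestorationQPPermSupportCount

/-! TTRL-lite variant V18924 of stmt-ValiantsHypothesis-15886 -/

-- `ValiantsHypothesis.ValiantsHypothesis`: the D-0017 layout repeats the problem name in the path.
set_option linter.dupNamespace false

namespace Summit.ValiantsHypothesis.ValiantsHypothesis.Theorems

open Summit.ValiantsHypothesis.ValiantsHypothesis.Theses.MonotoneRestoration
open Literature.Computability.AlgebraicComplexity

/-- TTRL-lite variant V18924 (lemma proposal) of `stub_mulGate_children_extend`: in a
`×`-gate `P` with `eval P ≠ 0`, the cofactor of any child `h` — the product of `eval x` over the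
other children `x ∈ children P \ {h}` — is nonzero, since `eval P = eval h * cofactor`
(`LabelledArithCircuit.eval_of_label_mul` and `Finset.mul_prod_erase`) and a zero cofactor would
force `eval P = 0`. This is the second `have` of the parent stub's proof, the step consuming
`hP0`. [folklore] -/
theorem stub_mulGate_children_extend_var18924 :
    ∀ (n : ℕ) (G : Type) [DecidableEq G] (C : LabelledArithCircuit NNReal (Fin n × Fin n) Unit G)
      (P h : G), C.label P = .mul → C.eval P ≠ 0 → h ∈ C.children P →
      (∏ x ∈ (C.children P).erase h, C.eval x) ≠ 0 := by
  intro n G _ C P h hP hP0 hh hzero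
  apply hP0
  rw [C.eval_of_label_mul hP, ← Finset.mul_prod_erase (C.children P) (fun x => C.eval x) hh]
  simp only [hzero, mul_zero]

end Summit.ValiantsHypothesis.ValiantsHypothesis.Theorems
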